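import Literature.NumberTheory.Sieve.FGKMT2018Theorem5Local
import Literature.NumberTheory.Sieve.MaynardTao
import HarnessLib

/-!
# Ford–Green–Konyagin–Maynard–Tao 2018, §7: the multidimensional sieve weights `w_{k,𝓛,B,R}` and
# Theorem 6 with Lemma 7.2 (the case `𝒜 = ℤ`, `θ = 1/3`, `B` = the Landau–Page exceptional prime) — STATEMENT

Topic `Literature/NumberTheory/Sieve`. Sources: K. Ford, B. Green, S. Konyagin, J. Maynard, T. Tao,
*Long gaps between primes*, J. Amer. Math. Soc. 31 (2018) 65–105 = arXiv:1412.5029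
[FordGreenKonyaginMaynardTao2018], §7 pp. 20–22 (Definition 2 = Hypothesis 1, Lemma 7.1
(Landau–Page), Corollary 5, Lemma 7.2, the weights (7.x) `W, ω_𝓛, j_{p,a}, 𝒟_k(𝓛), 𝔖(𝓛), 𝔖_{WB}(𝓛),
φ_ω, y_r, λ_d, w`, Theorem 6) and §8 pp. 22–24 (how Theorem 6 is applied); J. Maynard, *Dense
clusters of primes in subsets*, Compositio Math. 152 (2016) 1517–1554 = arXiv:1405.2593
[Maynard2016Dense], §7 p. 13 (the weights `w_n`, INCLUDING the cut-off `w_n = 0` if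
`(∏ L_i(n), W) ≠ 1`), Proposition 6.1 p. 9, Lemma 8.1(i) p. 15 (`𝔖_B(𝓛) ≥ e^{-Ck}`), Lemma 8.6
p. 17 (`I_k ≫ (2k log k)^{-k}`, `J_k/I_k ≍ log k/k`), Propositions 9.1, 9.2, 9.4 pp. 19–24.

WHAT IS TYPED. The weight `w = w_{k,𝓛,B,R}` of [FGKMT, (7.5)–(7.9) p. 21] for a family
`𝓛 = (L_1,…,L_k)` of linear forms `L_i(n) = a_i n + b_i` (here `L : Fin k → ℤ × ℤ`, `L i = (a_i, b_i)`),
exceptional modulus `B`, level `R` and cutoff function `F` (restricted to the simplex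
`𝓡_k = {t ≥ 0, ∑ tᵢ ≤ 1}` inside the definition, as in `maynardWeight`):
`W = ∏_{p ≤ 2k², p ∤ B} p` (`wCut`), `ω_𝓛(p)` (`omegaL`), `𝒟_k(𝓛)` (`dkBox`: `μ²(∏ dᵢ) = 1`,
`(∏ dᵢ, WB) = 1`, and `p ∣ d_j` only if `j` is the least index vanishing at some root of `∏ L_i mod p`),
`𝔖_D(𝓛) = ∏_{p ∤ D} (1 − ω(p)/p)(1 − 1/p)^{-k}` (`singSeriesExcl`, an ordered limit like
`singularSeries`), `φ_ω` (`phiOmega`), `y_r` (`yVar`), `λ_d` (`lamVar`) and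
`w(n) = 1_{(L_i(n), W) = 1 ∀ i} (∑_{d ∈ 𝒟_k, dᵢ ∣ L_i(n)} λ_d)²` (`sieveWt`). NOTE the coprimality
cut-off: it is part of Maynard's definition [Maynard2016Dense, §7 p. 13: «w_n … defined to be 0 if
∏ L_i(n) is a multiple of any prime p ≤ 2k² with p ∤ B»] and of the proofs of his Propositions
9.1/9.2 («if (∏ L_i(v₀), W) ≠ 1 then w_n = 0»), on which [FGKMT, Thm 6] rests; the display (7.9) of
[FGKMT] omits it, but without it (a) below is false (the `n` with some `L_i(n)` divisible by a prime
`≤ 2k²` would inflate `∑ w(n)` by the factor `∏_{p ∣ W} (1 − ω(p)/p)^{-1} ≫ 1`). For the application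
in §8 the cut-off is immaterial (only (6.3)–(6.6) of the resulting `w(p, n)` are used).

THE NAMED FACT `FordGreenKonyaginMaynardTao2018_theorem6ZN` is Theorem 6 COMBINED with Lemma 7.2,
i.e. exactly the form in which §8 invokes it («applying (7.x) of Theorem 6 … using Lemma 7.2 to obtain
Hypothesis 1»): `𝒜 = ℤ`, `θ = 1/3`, and `B = B(x) ≤ x` (equal to `1` or a prime) the exceptional
modulus of Lemma 7.2; for all admissible non-degenerate `𝓛` with `C ≤ k ≤ log^{1/5} x`,
`1 ≤ |a_i| ≤ log x`, `|b_i| ≤ x log² x`, all scales `x/2 ≤ X ≤ x log² x` and levels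
`X^{1/30} ≤ R ≤ X^{1/9}`:
the singular-series bound `𝔖(𝓛) ≥ e^{-Kk}` [Maynard2016Dense, Lemma 8.1(i)], (a) = (7.12),
(b) = (7.13) for the forms with `(a_L, B) = 1` and `L > R` on `[X, 2X]` (these constitute the `𝓛'`
of Lemma 7.2), (c) = (7.14), (d) = (7.15) `w(n) ≤ X^{2/9 + ε}`, with ONE absolute constant `K`,
and `F = F_k`, `I_k`, `J_k` depending only on `k` with `I_k ≫ (2k log k)^{-k}`,
`J_k ≍ (log k/k) I_k` (7.10)–(7.11). Typing remarks: (i) the scale window starts at `x/2` (the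
printed Lemma 7.2 has `x ≤ y`; §8 applies (7.13) at scale `x/2` — its proof, p. 21, is uniform
for all `z ≤ x log⁴ x`); (ii) `k ≤ log^{1/5} x` refers to the ambient `x`, as in §8 (`k = r ≤
log^{1/5} x` at scales `x/2`, `2y`, `y − x`); (iii) Hypothesis 1 itself is not an interface of this
fact (parts (1), (3) are trivial for `𝒜 = ℤ`; part (2) is Lemma 7.2's content) — it is recorded
below as `HypothesisOneZ` for reference only; (iv) the functionals `I_k(F)`, `J_k(F)` enter §8 only
as numbers, so they are existentially quantified reals here (a weakening of the printed statement).
This fact is the deep input of the edge «Theorem 6 ∧ Lemma 7.2 ⟹ Theorem 5 (local form)» (§8),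
whose target is `FordGreenKonyaginMaynardTao2018_theorem5_local`.

ERRATUM (2026-08-29) — NON-DEGENERACY. The printed Theorem 6 quantifies over «admissible» families
only, and so did the first rendering of this fact (`FordGreenKonyaginMaynardTao2018_theorem6Z`,
2026-08-27); but for a DEGENERATE admissible family (two proportional forms, e.g. `{L, −L}`) one has
`ω_𝓛(p) ≤ k − 1` for all `p`, the Euler product (7.6) diverges and `singSeriesExcl 𝓛 D` is the junk
value of `limUnder`, so the clauses `𝔖(𝓛) ≥ e^{−Kk}` and (7.12) of that rendering could not be
obtained from [Maynard2016Dense, Prop. 6.1] (whose forms are distinct with `a_i ≥ 1`, hence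
non-degenerate). The rendering was withdrawn (deleted 2026-08-29) in favour of
`FordGreenKonyaginMaynardTao2018_theorem6ZN` = the same text plus the hypothesis
`FormsNondegenerate 𝓛 : a_i b_j ≠ a_j b_i (i ≠ j)`. The §8 deduction only ever applies Theorem 6 to
the non-degenerate families `𝓛_p`, `L̃_{q,i}` and their translates, and goes through from
`…theorem6ZN` (`fgkmt2018_theorem5_local_of_theorem6ZN`, file `FGKMT2018Theorem5OfTheorem6.lean`).
-/

noncomputable section

open Finset Filter
open scoped ArithmeticFunction.Moebius

namespace Literature.NumberTheory.Sieve

namespace FGKMT2018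

/-! ### Linear forms, counting functions (FGKMT §7 p. 20, with `𝒜 = ℤ`) -/

/-- The value `L(n) = a n + b` of the linear form `L = (a, b)`.
[cite: FordGreenKonyaginMaynardTao2018, §7 p. 20] -/
def formEval (l : ℤ × ℤ) (n : ℤ) : ℤ := l.1 * n + l.2

/-- Admissibility of a finite family of linear forms: all `a_i ≠ 0` and `∏ L_i(n)` has no fixed prime
divisor. [cite: FordGreenKonyaginMaynardTao2018, §7 p. 20] -/
def FormsAdmissible {k : ℕ} (L : Fin k → ℤ × ℤ) : Prop :=
  (∀ i, (L i).1 ≠ 0) ∧ ∀ p : ℕ, p.Prime → ∃ n : ℤ, ¬ (p : ℤ) ∣ ∏ i, formEval (L i) n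

/-- Non-degeneracy of a family of linear forms: no two forms are proportional, `a_i b_j ≠ a_j b_i`
for `i ≠ j` (Maynard's standing normalisation «distinct `L_i` with `a_i ≥ 1`, `(a_i, b_i) = 1`»
implies it; FGKMT allow negative `a_i`, so it is recorded separately). It is exactly the condition
under which `ω_𝓛(p) = k` for all large `p ∤ ∏ a_i`, i.e. under which the singular series `𝔖_D(𝓛)`
of (7.6)–(7.7) converges; without it (e.g. `𝓛 = {L, −L}`, admissible with `ω ≡ 1 < 2`) the partial
products of `𝔖` tend to `+∞`. It is invariant under the translations of §8 and holds for the §8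
families `𝓛_p`, `L̃_{q,i}`.
[cite: FordGreenKonyaginMaynardTao2018, §7 p. 20 («a finite set 𝓛 = {L_1,…,L_k} of linear forms»); Maynard2016Dense §1 (distinct linear functions)] -/
def FormsNondegenerate {k : ℕ} (L : Fin k → ℤ × ℤ) : Prop :=
  ∀ i j : Fin k, i ≠ j → (L i).1 * (L j).2 ≠ (L j).1 * (L i).2

/-- `𝒜(X) = {n ∈ ℤ : X ≤ n ≤ 2X}` for `𝒜 = ℤ`. [cite: FordGreenKonyaginMaynardTao2018, §7 p. 20] -/
def dyadZ (X : ℝ) : Finset ℤ := Finset.Icc ⌈X⌉ ⌊2 * X⌋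

/-- `#𝒫_{L,ℤ}(X) = #{n ∈ 𝒜(X) : L(n) is a (positive) prime}` (`L` is injective, so this is the number
of primes in `L(𝒜(X))`). [cite: FordGreenKonyaginMaynardTao2018, §7 p. 20] -/
def primeCountZ (l : ℤ × ℤ) (X : ℝ) : ℕ :=
  #((dyadZ X).filter fun n => 0 < formEval l n ∧ (formEval l n).natAbs.Prime)

/-- `#𝒫_{L,ℤ}(X; q, a)`: the same with `n ≡ a (mod q)`. [cite: FordGreenKonyaginMaynardTao2018, §7 p. 20] -/
def primeCountZMod (l : ℤ × ℤ) (X : ℝ) (q : ℕ) (a : ℤ) : ℕ :=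
  #((dyadZ X).filter fun n => n ≡ a [ZMOD q] ∧ 0 < formEval l n ∧ (formEval l n).natAbs.Prime)

/-- `φ_L(q) = φ(|a| q)/φ(|a|)` for `L = (a, b)`. [cite: FordGreenKonyaginMaynardTao2018, §7 p. 20] -/
def totForm (l : ℤ × ℤ) (q : ℕ) : ℝ :=
  (Nat.totient (l.1.natAbs * q) : ℝ) / Nat.totient l.1.natAbs

/-- **Hypothesis 1, part (2), for `𝒜 = ℤ`** at one form `L`, scale `X`, level `X^θ`, exceptional
modulus `B`, exponent parameter `k` and constant `C`:
`∑_{q ≤ X^θ, (q,B)=1} max_{a : (L(a),q)=1} |#𝒫_L(X;q,a) − #𝒫_L(X)/φ_L(q)| ≤ C #𝒫_L(X)/log^{100k²} X`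
(the maximum rendered as a supremum over choices of residues `a(q)`, a modulus `q` admitting no `a`
with `(L(a), q) = 1` contributing `0`). Parts (1) and (3) of Hypothesis 1 concern `𝒜` only and are
trivial for `𝒜 = ℤ`. Recorded for reference (not an interface of the named fact below).
[cite: FordGreenKonyaginMaynardTao2018, Definition 2 (Hypothesis 1) p. 20] -/
def HypothesisOneZ (θ : ℝ) (B k : ℕ) (X : ℝ) (l : ℤ × ℤ) (C : ℝ) : Prop :=
  ∀ a : ℕ → ℤ,
    ∑ q ∈ (Finset.Icc 1 ⌊X ^ θ⌋₊).filter (fun q => Nat.Coprime q B),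
        (if Int.gcd (formEval l (a q)) q = 1 then
          |(primeCountZMod l X q (a q) : ℝ) - primeCountZ l X / totForm l q| else 0)
      ≤ C * primeCountZ l X / Real.log X ^ (100 * k ^ 2)

/-! ### The sieve weights (FGKMT (7.5)–(7.9) p. 21 = Maynard 2016 §7 p. 13) -/

/-- `W = ∏_{p ≤ 2k², p ∤ B} p`. [cite: FordGreenKonyaginMaynardTao2018, §7 p. 21] -/
def wCut (k B : ℕ) : ℕ :=
  ∏ p ∈ (Finset.range (2 * k ^ 2 + 1)).filter (fun p => p.Prime ∧ ¬ p ∣ B), p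

/-- `ω_𝓛(p) = #{n mod p : p ∣ ∏ᵢ L_i(n)}`. [cite: FordGreenKonyaginMaynardTao2018, §7 p. 21] -/
def omegaL {k : ℕ} (L : Fin k → ℤ × ℤ) (p : ℕ) : ℕ :=
  #((Finset.range p).filter fun n : ℕ => (p : ℤ) ∣ ∏ i, formEval (L i) n)

/-- `𝒟_k(𝓛)` (inside the box `1 ≤ dᵢ ≤ ⌊R⌋`, which contains the support `∏ dᵢ ≤ R` of `λ`):
`μ²(d₁⋯d_k) = 1`, `(d₁⋯d_k, WB) = 1`, and `p ∣ d_j` only if `j = j_{p,a}` is the least index with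
`p ∣ L_j(r_{p,a})` for some root `r_{p,a}` of `∏ L_i mod p`.
[cite: FordGreenKonyaginMaynardTao2018, (7.5) p. 21] -/
def dkBox {k : ℕ} (L : Fin k → ℤ × ℤ) (B : ℕ) (R : ℝ) : Finset (Fin k → ℕ) :=
  (Fintype.piFinset fun _ : Fin k => Finset.Icc 1 ⌊R⌋₊).filter fun d =>
    Squarefree (∏ i, d i) ∧ Nat.Coprime (∏ i, d i) (wCut k B * B) ∧
      ∀ j : Fin k, ∀ p ∈ (d j).primeFactors,
        ∃ n ∈ Finset.range p, (p : ℤ) ∣ formEval (L j) n ∧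
          ∀ j' : Fin k, j' < j → ¬ (p : ℤ) ∣ formEval (L j') n

/-- The Euler factor `(1 − ω_𝓛(p)/p)(1 − 1/p)^{-k}`. [cite: FordGreenKonyaginMaynardTao2018, (7.6) p. 21] -/
def singFactor {k : ℕ} (L : Fin k → ℤ × ℤ) (p : ℕ) : ℝ :=
  (1 - (omegaL L p : ℝ) / p) * (1 - 1 / (p : ℝ))⁻¹ ^ k

/-- Partial product `∏_{p ≤ x, p ∤ D} (1 − ω(p)/p)(1 − 1/p)^{-k}`.
[cite: FordGreenKonyaginMaynardTao2018, (7.6) p. 21] -/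
def singPartial {k : ℕ} (L : Fin k → ℤ × ℤ) (D : ℕ) (x : ℕ) : ℝ :=
  ∏ p ∈ (Finset.range (x + 1)).filter (fun p => p.Prime ∧ ¬ p ∣ D), singFactor L p

/-- `𝔖_D(𝓛) = ∏_{p ∤ D} (1 − ω_𝓛(p)/p)(1 − 1/p)^{-k}` as an ordered limit (cf. `singularSeries`);
`𝔖(𝓛) = 𝔖_B(𝓛)` and `𝔖_{WB}(𝓛)` are the cases `D = B`, `D = WB`.
[cite: FordGreenKonyaginMaynardTao2018, (7.6)–(7.7) p. 21] -/
def singSeriesExcl {k : ℕ} (L : Fin k → ℤ × ℤ) (D : ℕ) : ℝ :=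
  limUnder atTop (singPartial L D)

/-- `φ_ω(m) = ∏_{p ∣ m} (p − ω_𝓛(p))`. [cite: FordGreenKonyaginMaynardTao2018, (7.8) p. 21] -/
def phiOmega {k : ℕ} (L : Fin k → ℤ × ℤ) (m : ℕ) : ℝ :=
  ∏ p ∈ m.primeFactors, ((p : ℝ) - omegaL L p)

/-- `y_r = (WB)^k/φ(WB)^k · 𝔖_{WB}(𝓛) · F(log r₁/log R, …, log r_k/log R)` (for `r ∈ 𝒟_k(𝓛)`; the
indicator `1_{𝒟_k}` is carried by the summation ranges below), with `F` restricted to the simplex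
`𝓡_k`. [cite: FordGreenKonyaginMaynardTao2018, §7 p. 21 (definition of y_r)] -/
def yVar {k : ℕ} (L : Fin k → ℤ × ℤ) (B : ℕ) (R : ℝ) (F : (Fin k → ℝ) → ℝ) (r : Fin k → ℕ) : ℝ :=
  ((wCut k B * B : ℕ) : ℝ) ^ k / (Nat.totient (wCut k B * B) : ℝ) ^ k *
    singSeriesExcl L (wCut k B * B) *
      (maynardSimplex k).indicator F (fun i => Real.log (r i) / Real.log R)

/-- `λ_d = μ(d₁⋯d_k) d₁⋯d_k ∑_{r ∈ 𝒟_k(𝓛), dᵢ ∣ rᵢ ∀ i} y_r/φ_ω(r₁⋯r_k)`.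
[cite: FordGreenKonyaginMaynardTao2018, §7 p. 21 (definition of λ_d)] -/
def lamVar {k : ℕ} (L : Fin k → ℤ × ℤ) (B : ℕ) (R : ℝ) (F : (Fin k → ℝ) → ℝ) (d : Fin k → ℕ) : ℝ :=
  ((μ (∏ i, d i) : ℤ) : ℝ) * (∏ i, (d i : ℝ)) *
    ∑ r ∈ (dkBox L B R).filter (fun r => ∀ i, d i ∣ r i), yVar L B R F r / phiOmega L (∏ i, r i)

/-- The weight `w_{k,𝓛,B,R}(n) = 1_{(L_i(n), W) = 1 ∀ i} · (∑_{d ∈ 𝒟_k(𝓛), dᵢ ∣ L_i(n) ∀ i} λ_d)²`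
(Maynard's cut-off made explicit, see the module docstring).
[cite: FordGreenKonyaginMaynardTao2018, (7.9) p. 21; Maynard2016Dense §7 p. 13] -/
def sieveWt {k : ℕ} (L : Fin k → ℤ × ℤ) (B : ℕ) (R : ℝ) (F : (Fin k → ℝ) → ℝ) (n : ℤ) : ℝ :=
  if ∀ i, Int.gcd (formEval (L i) n) (wCut k B) = 1 then
    (∑ d ∈ (dkBox L B R).filter (fun d => ∀ i, ((d i : ℕ) : ℤ) ∣ formEval (L i) n),
        lamVar L B R F d) ^ 2
  else 0

/-- `Δ_L = |a₀| ∏_j |a₀ b_j − a_j b₀|` for `L₀ = (a₀, b₀)` against `𝓛`.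
[cite: FordGreenKonyaginMaynardTao2018, Thm 6 (7.14) p. 22] -/
def discDelta {k : ℕ} (L : Fin k → ℤ × ℤ) (l₀ : ℤ × ℤ) : ℕ :=
  l₀.1.natAbs * ∏ j, (l₀.1 * (L j).2 - (L j).1 * l₀.2).natAbs

/-- `B/φ(B)`. [cite: FordGreenKonyaginMaynardTao2018, Thm 6 p. 21] -/
def bOverPhi (B : ℕ) : ℝ := (B : ℝ) / Nat.totient B

/-- Main term of (7.12): `(B/φ(B))^k 𝔖(𝓛) #𝒜(X) (log R)^k I_k`.
[cite: FordGreenKonyaginMaynardTao2018, (7.12) p. 21] -/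
def mainTermA {k : ℕ} (L : Fin k → ℤ × ℤ) (B : ℕ) (X R I : ℝ) : ℝ :=
  bOverPhi B ^ k * singSeriesExcl L B * #(dyadZ X) * Real.log R ^ k * I

/-- Main term of (7.13) for the form `L_i = (a_i, b_i)`:
`(φ(|a_i|)/|a_i|) (B/φ(B))^{k−1} 𝔖(𝓛) #𝒫_{L_i}(X) (log R)^{k+1} J_k`.
[cite: FordGreenKonyaginMaynardTao2018, (7.13) p. 21] -/
def mainTermB {k : ℕ} (L : Fin k → ℤ × ℤ) (B : ℕ) (X R J : ℝ) (i : Fin k) : ℝ :=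
  (Nat.totient (L i).1.natAbs : ℝ) / (L i).1.natAbs * bOverPhi B ^ (k - 1) * singSeriesExcl L B *
    primeCountZ (L i) X * Real.log R ^ (k + 1) * J

/-- Secondary term of (7.13)/(7.14): `(B/φ(B))^k 𝔖(𝓛) #𝒜(X) (log R)^{k−1} I_k`.
[cite: FordGreenKonyaginMaynardTao2018, (7.13)–(7.14) pp. 21–22] -/
def errTermB {k : ℕ} (L : Fin k → ℤ × ℤ) (B : ℕ) (X R I : ℝ) : ℝ :=
  bOverPhi B ^ k * singSeriesExcl L B * #(dyadZ X) * Real.log R ^ (k - 1) * I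

/-- The weight is non-negative («w : ℤ → ℝ⁺», [FGKMT (7.9)]). [cite: FordGreenKonyaginMaynardTao2018, (7.9) p. 21 (w takes values in ℝ⁺)] -/
theorem sieveWt_nonneg {k : ℕ} (L : Fin k → ℤ × ℤ) (B : ℕ) (R : ℝ) (F : (Fin k → ℝ) → ℝ) (n : ℤ) :
    0 ≤ sieveWt L B R F n := by
  unfold sieveWt
  split_ifs
  · exact sq_nonneg _
  · exact le_rfl

/-- The weight depends on `n` only through the values `L_i(n)`: a common shift of all forms is a
shift of the argument (`w_{𝓛 − c}(n + c) = w_𝓛(n)` in the notation of §8).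
[cite: FordGreenKonyaginMaynardTao2018, §8 p. 23 (shifting the n variable)] -/
theorem formEval_shift (l : ℤ × ℤ) (c n : ℤ) :
    formEval (l.1, l.2 - l.1 * c) (n + c) = formEval l n := by
  unfold formEval; ring

end FGKMT2018

open FGKMT2018

/-- **Theorem 6 with Lemma 7.2 (`𝒜 = ℤ`, `θ = 1/3`, `B` the Landau–Page exceptional modulus), non-degenerate families** of
[FordGreenKonyaginMaynardTao2018, §7 pp. 20–22], in the form used in §8. There are an absolute
threshold `C`, an absolute constant `K > 0`, functions `F_k : ℝ^k → ℝ` and reals `I_k, J_k > 0`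
(`k ≥ C`) with `(2k log k)^{-k} ≤ K I_k`, `(log k/k) I_k ≤ K J_k`, `J_k ≤ K (log k/k) I_k`
((7.10)–(7.11)), such that for every `ε > 0` and all large `x` there is `B ≤ x`, `B = 1` or prime
(Lemma 7.2), such that for all admissible NON-DEGENERATE (`FormsNondegenerate`: `a_i b_j ≠ a_j b_i`
for `i ≠ j`) families `𝓛 = (L_1,…,L_k)`, `C ≤ k ≤ log^{1/5} x`, `1 ≤ |a_i| ≤ log x`,
`|b_i| ≤ x log² x`, all `x/2 ≤ X ≤ x log² x` and `X^{1/30} ≤ R ≤ X^{1/9}`, with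
`w = w_{k,𝓛,B,R}` built from `F_k`: `𝔖(𝓛) ≥ e^{-Kk}`; (7.12)
`|∑_{n ∈ 𝒜(X)} w(n) − M_a| ≤ (K/log^{1/10} X) M_a`; (7.13) for every `i` with `(a_i, B) = 1` and
`L_i > R` on `𝒜(X)`: `|∑_{n ∈ 𝒜(X), L_i(n) prime} w(n) − M_b| ≤ (K/log^{1/10} X) M_b + K E`; (7.14) for
every form `L₀ = (a₀, b₀)`, `a₀ ≠ 0`, `|a₀|, |b₀| ≤ X²`, `Δ_{L₀} ≠ 0`:
`∑_{n ∈ 𝒜(X), L₀(n) prime > X^{1/30}} w(n) ≤ K (Δ/φ(Δ)) E`; (7.15) `w(n) ≤ X^{2/9 + ε}`.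
ERRATUM (2026-08-29): the first rendering of this fact (`FordGreenKonyaginMaynardTao2018_theorem6Z`,
2026-08-27, withdrawn and deleted 2026-08-29) omitted the non-degeneracy hypothesis; for degenerate
admissible families such as `{L, −L}` one has `ω_𝓛(p) ≤ k − 1` for every `p`, the Euler product
`𝔖_B(𝓛)` DIVERGES and `singSeriesExcl` is the junk value of `limUnder`, so the clauses
`e^{−Kk} ≤ 𝔖(𝓛)` and (7.12) of that rendering were statements about a junk real, not derivable from
[Maynard2016Dense, Prop. 6.1] (whose forms are distinct with `a_i ≥ 1`, hence non-degenerate). The §8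
deduction (`fgkmt2018_theorem5_local_of_theorem6ZN`) needs only the present statement, since the §8
families `𝓛_p = {n + h_i p}`, `L̃_{q,i}` and their translates are non-degenerate.
[cite: FordGreenKonyaginMaynardTao2018, Thm 6 pp. 21–22 with Lemma 7.2 p. 20 (as applied in §8 pp. 22–24); Maynard2016Dense Prop. 6.1, Lemmas 8.1, 8.6] -/
def FordGreenKonyaginMaynardTao2018_theorem6ZN : Prop :=
  ∃ (C : ℕ) (K : ℝ) (F : (k : ℕ) → (Fin k → ℝ) → ℝ) (I J : ℕ → ℝ), 0 < K ∧
    (∀ k : ℕ, C ≤ k →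
      0 < I k ∧ (2 * (k : ℝ) * Real.log k) ^ (-(k : ℝ)) ≤ K * I k ∧
        Real.log k / k * I k ≤ K * J k ∧ J k ≤ K * (Real.log k / k * I k)) ∧
    ∀ ε : ℝ, 0 < ε → ∀ᶠ x : ℕ in atTop, ∃ B : ℕ, (B = 1 ∨ B.Prime) ∧ B ≤ x ∧
      ∀ (k : ℕ) (L : Fin k → ℤ × ℤ) (X R : ℝ), C ≤ k → (k : ℝ) ≤ Real.log x ^ ((1 : ℝ) / 5) →
        FormsAdmissible L → FormsNondegenerate L →
        (∀ i, |(((L i).1 : ℤ) : ℝ)| ≤ Real.log x ∧ |(((L i).2 : ℤ) : ℝ)| ≤ x * Real.log x ^ 2) →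
        (x : ℝ) / 2 ≤ X → X ≤ x * Real.log x ^ 2 →
        X ^ ((1 : ℝ) / 30) ≤ R → R ≤ X ^ ((1 : ℝ) / 9) →
        Real.exp (-(K * k)) ≤ singSeriesExcl L B ∧
        |∑ n ∈ dyadZ X, sieveWt L B R (F k) n - mainTermA L B X R (I k)|
            ≤ K / Real.log X ^ ((1 : ℝ) / 10) * mainTermA L B X R (I k) ∧
        (∀ i : Fin k, Nat.Coprime (L i).1.natAbs B → (∀ n ∈ dyadZ X, R < (formEval (L i) n : ℝ)) →
          |∑ n ∈ (dyadZ X).filter (fun n => 0 < formEval (L i) n ∧ (formEval (L i) n).natAbs.Prime),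
                sieveWt L B R (F k) n - mainTermB L B X R (J k) i|
            ≤ K / Real.log X ^ ((1 : ℝ) / 10) * mainTermB L B X R (J k) i
                + K * errTermB L B X R (I k)) ∧
        (∀ l₀ : ℤ × ℤ, l₀.1 ≠ 0 → |((l₀.1 : ℤ) : ℝ)| ≤ X ^ 2 → |((l₀.2 : ℤ) : ℝ)| ≤ X ^ 2 →
          (∀ j, l₀.1 * (L j).2 - (L j).1 * l₀.2 ≠ 0) →
          ∑ n ∈ (dyadZ X).filter (fun n => 0 < formEval l₀ n ∧ (formEval l₀ n).natAbs.Prime ∧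
              X ^ ((1 : ℝ) / 30) < (formEval l₀ n : ℝ)), sieveWt L B R (F k) n
            ≤ K * ((discDelta L l₀ : ℝ) / Nat.totient (discDelta L l₀)) * errTermB L B X R (I k)) ∧
        (∀ n : ℤ, sieveWt L B R (F k) n ≤ X ^ ((2 : ℝ) / 9 + ε))

end Literature.NumberTheory.Sieve
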